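import Summits.HodgeConjecture.HodgeConjecture.Theses.PadicSemiregularLift
import Summits.HodgeConjecture.HodgeConjecture.Theorems.FormalLiftingFromClassLifting.Negative.OneStepClassLift

/-!
# `FormalLiftingFromClassLifting` (stmt-HodgeConjecture-13825) · Negative · the stubs of line
`pro-class-correction-syntomic` as targets

Kernel-checked, `def`-free by-products of the standing disprover's cycle 3
(refuter-cdisprove-stmt-HodgeConjecture-13825-g3-0, 2026-08-16; workfile
`Cruxes/FormalLiftingFromClassLifting/Disproof.lean` §10) about the stubs of the PICKED line
`Cruxes/…/Lines/pro-class-correction-syntomic.lean`: S1 `stub_kernelTowerSurjective` ((2_K)),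
S2 `stub_pSaturation` (`p • y` lifts to every level ⇒ `y` does), S3 `stub_primeToPLifting` (level-wise
prime-to-`p` divisibility of `im(K₀(X_{n+1}) → K₀(X_k))`); stub conclusions are spelled out VERBATIM.
* (T1) `exists_lift_level_zero`, `primeToPLifting_level_zero`, `kernelTowerSurjective_level_zero`: the
  level-`0` instances of S1–S3 hold for every `W(k)`-scheme, `k` perfect (`X_k ≅ X_1 = 𝒳 ⊗ W/p`).
* (T2) `exists_lift_all_levels_of_stubs`: S2 ∧ S3 at `𝒳` + the crux's rational pro-class force the
  INTEGRAL class `[E₁]` into `im(K₀(X_{n+1}) → K₀(X_k))` for EVERY `n` (clearing denominators in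
  `ℚ ⊗ lim_n K₀(X_n)` — credit: the line's skeleton, planner-cruxplan-…-pro-class-correction-0 — then
  `p`-power and prime-to-`p` saturation); so `not_pSaturation_or_not_primeToPLifting_of_oneStepWitness`:
  the one-step witness of `Negative/OneStepClassLift.lean` is EXACTLY a counterexample to S2 or to S3
  at the same `𝒳` — the disprover's kill criterion and the stub attack are one search.
* (T3) toy tightness (abstract towers `A (n+1) → A n`, restrictions `res n : A n → A 0`; dictionary
  `A (n+1) = K₀(X_{n+1})`, `A 0 = K₀(X_k)`): `pSaturation_independent_toy` — S2 does not follow from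
  S1 + "all cokernels killed by one prime" (the Godeaux–Serre shape: `lim` of the obstruction groups has
  torsion); `levelwiseLifts_not_compatible_toy` — lifts at every level give no compatible family without
  S1 (a `lim¹` toy), which is why the line spends S1 inside its step lifting instead.
Paper status (Disproof.lean cycle 3 (K)–(M)): S1–S3 are theorems on paper, so neither disjunct of (T2)
can be realised; this is the formal frame in which any future witness would be checked.
-/

set_option linter.dupNamespace false

namespace Summit.HodgeConjecture.HodgeConjecture.Theorems.FormalLiftingFromClassLifting.Negative

open CategoryTheory AlgebraicGeometry Limits
open scoped TensorProduct
open Literature.AlgebraicGeometry Literature.AlgebraicGeometry.Motives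
open Literature.AlgebraicGeometry.Motives.WittScheme
open Summit.HodgeConjecture.HodgeConjecture.Theses.PadicSemiregularLift

noncomputable section

variable {p : ℕ} [Fact p.Prime] {k : Type} [Field k] [CharP k p]

/-! ## (T1) Level `0` is free: `X_k ⟶ X_1` is an isomorphism for `k` perfect -/

section LevelZero

variable [PerfectRing k p]

/-- For `k` perfect, the residue map `W(k)/p → k` is bijective (`ker(W(k) → k) = (p)`, Mathlib
`WittVector.ker_constantCoeff`). [folklore] -/
theorem bijective_wittQuotToResidue_zero' : Function.Bijective (wittQuotToResidue p k 0) := by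
  constructor
  · unfold wittQuotToResidue
    refine RingHom.lift_injective_of_ker_le_ideal _ _ ?_
    rw [WittVector.ker_constantCoeff, zero_add, pow_one]
  · unfold wittQuotToResidue
    exact Ideal.Quotient.lift_surjective_of_surjective _ _ (WittVector.constantCoeff_surjective p)

variable (𝒳 : SchemeOver (WittVector p k))

/-- **`X_k ⟶ X_1 = 𝒳 ⊗ W/p` is an isomorphism** for `k` perfect (base change of `W(k)/p ≅ k`).
[folklore] -/
theorem isIso_specialFibreToThickening_zero' : IsIso (specialFibreToThickening 𝒳 0) := by
  have e : CommRingCat.ofHom (wittQuotToResidue p k 0) =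
      (RingEquiv.ofBijective (wittQuotToResidue p k 0)
        (bijective_wittQuotToResidue_zero' (p := p) (k := k))).toCommRingCatIso.hom := rfl
  have : IsIso (Spec.map (CommRingCat.ofHom (wittQuotToResidue p k 0))) := by
    rw [e]; infer_instance
  unfold specialFibreToThickening
  apply pullback.map_isIso

/-- **Every class of `K₀(X_k)` lifts to level `0`** (the `n = 0` instance of the conclusion of S2, and
the trivial half of everything level-wise). [folklore] -/
theorem exists_lift_level_zero (y : KTheory.KZero (specialFibre 𝒳).left) :
    ∃ z : KTheory.KZero (thickening 𝒳 1).left,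
      KTheory.KZero.map (specialFibreToThickening 𝒳 0) z = y := by
  haveI := isIso_specialFibreToThickening_zero' 𝒳
  exact ⟨KTheory.KZero.map (inv (specialFibreToThickening 𝒳 0)) y, by
    rw [← KTheory.KZero.map_comp_apply, IsIso.hom_inv_id, KTheory.KZero.map_id,
      AddMonoidHom.id_apply]⟩

/-- **S3 (`stub_primeToPLifting`) at level `n = 0` holds for every `𝒳`** (no smoothness, properness,
projectivity, and the premise is not needed). [folklore] -/
theorem primeToPLifting_level_zero (M : ℕ) (y : KTheory.KZero (specialFibre 𝒳).left) :
    (∃ z : KTheory.KZero (thickening 𝒳 1).left,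
      KTheory.KZero.map (specialFibreToThickening 𝒳 0) z = (M : ℤ) • y) →
    ∃ z : KTheory.KZero (thickening 𝒳 1).left,
      KTheory.KZero.map (specialFibreToThickening 𝒳 0) z = y :=
  fun _ => exists_lift_level_zero 𝒳 y

/-- **S1 (`stub_kernelTowerSurjective`) at level `n = 0` holds for every `𝒳`**: a class on `X_1` dying
on `X_k ≅ X_1` is `0`. [folklore] -/
theorem kernelTowerSurjective_level_zero (t : KTheory.KZero (thickening 𝒳 1).left)
    (ht : KTheory.KZero.map (specialFibreToThickening 𝒳 0) t = 0) :
    ∃ t' : KTheory.KZero (thickening 𝒳 2).left,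
      KTheory.KZero.map (specialFibreToThickening 𝒳 1) t' = 0 ∧
      KTheory.KZero.map (thickeningMap 𝒳 (Nat.le_succ 1)) t' = t := by
  haveI := isIso_specialFibreToThickening_zero' 𝒳
  have ht0 : t = 0 := by
    have h := congrArg (KTheory.KZero.map (inv (specialFibreToThickening 𝒳 0))) ht
    rwa [← KTheory.KZero.map_comp_apply, IsIso.inv_hom_id, KTheory.KZero.map_id,
      AddMonoidHom.id_apply, map_zero] at h
  exact ⟨0, by rw [map_zero], by rw [map_zero, ht0]⟩

end LevelZero

/-! ## (T2) S2 ∧ S3 at `𝒳` + rational pro-class ⇒ `[E₁]` lifts integrally to every level -/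

section Saturation

variable (𝒳 : SchemeOver (WittVector p k))

omit [CharP k p] in
/-- The `KTheory` transition `X ⊗ W/p^{n+1} ⟶ X ⊗ W/p^{n+2}` IS the `WittScheme` transition
`X_{n+1} ⟶ X_{n+2}` (credit: the line's skeleton). [folklore] -/
theorem thickeningTransition_eq_thickeningMap (n : ℕ) :
    KTheory.thickeningTransition (Ideal.span {(p : WittVector p k)}) 𝒳 n =
      thickeningMap 𝒳 (Nat.le_succ (n + 1)) := by
  refine pullback.hom_ext ?_ ?_
  · unfold KTheory.thickeningTransition KTheory.thickeningι thickeningMap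
    erw [pullback.lift_fst]
  · unfold KTheory.thickeningTransition KTheory.thickeningStructureMap KTheory.truncSpecTransition
      thickeningMap
    erw [pullback.lift_snd]

omit [CharP k p] in
/-- Compatibility of a pro-class `η ∈ lim_n K₀(X_n)` with the `WittScheme` transition maps. [folklore] -/
theorem map_thickeningMap_proj (η : KTheory.LimKZero (Ideal.span {(p : WittVector p k)}) 𝒳) (n : ℕ) :
    KTheory.KZero.map (thickeningMap 𝒳 (Nat.le_succ (n + 1)))
        (KTheory.LimKZero.proj (Ideal.span {(p : WittVector p k)}) 𝒳 (n + 1) η) =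
      KTheory.LimKZero.proj (Ideal.span {(p : WittVector p k)}) 𝒳 n η :=
  (congrArg (fun φ : (thickening 𝒳 (n + 1)).left ⟶ (thickening 𝒳 (n + 2)).left =>
      KTheory.KZero.map φ (KTheory.LimKZero.proj (Ideal.span {(p : WittVector p k)}) 𝒳 (n + 1) η))
      (thickeningTransition_eq_thickeningMap 𝒳 n)).symm.trans
    (KTheory.LimKZero.map_proj_succ (Ideal.span {(p : WittVector p k)}) 𝒳 n η)

/-- Restricting the level-`n` component of a pro-class to `X_k` gives the restriction of its level-`0`
component along the crux's `Crystalline.specialFibreToTower`. [folklore] -/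
theorem map_specialFibreToThickening_proj
    (η : KTheory.LimKZero (Ideal.span {(p : WittVector p k)}) 𝒳) (n : ℕ) :
    KTheory.KZero.map (specialFibreToThickening 𝒳 n)
        (KTheory.LimKZero.proj (Ideal.span {(p : WittVector p k)}) 𝒳 n η) =
      KTheory.KZero.map (Crystalline.specialFibreToTower 𝒳)
        (KTheory.LimKZero.proj (Ideal.span {(p : WittVector p k)}) 𝒳 0 η) := by
  induction n with
  | zero => rfl
  | succ n ih =>
    rw [← ih, ← map_thickeningMap_proj 𝒳 η n, ← KTheory.KZero.map_comp_apply,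
      specialFibreToThickening_comp_thickeningMap]

variable {𝒳}

/-- **CLEARING DENOMINATORS** (credit: the line's skeleton `exists_int_multiple_liftsToAllLevels`):
from the crux's rational pro-class `ξ ∈ ℚ ⊗_ℤ lim_n K₀(X_n)` under `[E₁] ⊗ 1`, some `M ≠ 0` has
`M • [E₁] ∈ im(K₀(X_{n+1}) → K₀(X_k))` for every `n`. [folklore] -/
theorem exists_int_multiple_lifts_all_levels {E₁ : (specialFibre 𝒳).left.Modules}
    (hE₁ : IsFiniteLocallyFree E₁)
    (hξ : ∃ ξ : KTheory.ContinuousKZeroRat (Ideal.span {(p : WittVector p k)}) 𝒳,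
      KTheory.KZeroRat.map (Crystalline.specialFibreToTower 𝒳)
        (KTheory.ContinuousKZeroRat.specialFibre (Ideal.span {(p : WittVector p k)}) 𝒳 ξ) =
        KTheory.KZeroRat.of E₁ hE₁) :
    ∃ M : ℤ, M ≠ 0 ∧ ∀ n : ℕ, ∃ z : KTheory.KZero (thickening 𝒳 (n + 1)).left,
      KTheory.KZero.map (specialFibreToThickening 𝒳 n) z = M • KTheory.KZero.of E₁ hE₁ := by
  classical
  obtain ⟨ξ, hξ⟩ := hξ
  obtain ⟨⟨η, c⟩, hc⟩ := IsLocalizedModule.surj (nonZeroDivisors ℤ)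
    (TensorProduct.mk ℤ ℚ (KTheory.LimKZero (Ideal.span {(p : WittVector p k)}) 𝒳) 1) ξ
  have hcq : ((c : ℤ) : ℚ) • ξ = (1 : ℚ) ⊗ₜ[ℤ] η := by
    rw [Int.cast_smul_eq_zsmul ℚ]
    exact hc
  have h1 : TensorProduct.mk ℤ ℚ (KTheory.KZero (specialFibre 𝒳).left) 1
        ((c : ℤ) • KTheory.KZero.of E₁ hE₁) =
      TensorProduct.mk ℤ ℚ (KTheory.KZero (specialFibre 𝒳).left) 1
        (KTheory.KZero.map (Crystalline.specialFibreToTower 𝒳)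
          (KTheory.LimKZero.proj (Ideal.span {(p : WittVector p k)}) 𝒳 0 η)) := by
    have h := congrArg (fun ζ => KTheory.KZeroRat.map (Crystalline.specialFibreToTower 𝒳)
      (KTheory.ContinuousKZeroRat.specialFibre (Ideal.span {(p : WittVector p k)}) 𝒳 ζ)) hcq
    simp only [map_smul] at h
    rw [hξ, KTheory.ContinuousKZeroRat.proj_tmul, KTheory.KZeroRat.map_tmul] at h
    simp only [TensorProduct.mk_apply]
    rw [← h, KTheory.KZeroRat.of, TensorProduct.smul_tmul', smul_eq_mul, mul_one,
      ← Int.smul_one_eq_cast, TensorProduct.smul_tmul]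
  obtain ⟨c', hc'⟩ := IsLocalizedModule.exists_of_eq (S := nonZeroDivisors ℤ)
    (f := TensorProduct.mk ℤ ℚ (KTheory.KZero (specialFibre 𝒳).left) 1) h1
  simp only [Submonoid.smul_def] at hc'
  refine ⟨(c' : ℤ) * (c : ℤ),
    mul_ne_zero (nonZeroDivisors.coe_ne_zero c') (nonZeroDivisors.coe_ne_zero c), fun n => ?_⟩
  -- read the level-`n` component of `η` on the `WittScheme` tower (a type ascription, `rfl`)
  let w : KTheory.KZero (thickening 𝒳 (n + 1)).left :=
    KTheory.LimKZero.proj (Ideal.span {(p : WittVector p k)}) 𝒳 n η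
  have hw : KTheory.KZero.map (specialFibreToThickening 𝒳 n) w =
      KTheory.KZero.map (Crystalline.specialFibreToTower 𝒳)
        (KTheory.LimKZero.proj (Ideal.span {(p : WittVector p k)}) 𝒳 0 η) :=
    map_specialFibreToThickening_proj 𝒳 η n
  refine ⟨(c' : ℤ) • w, ?_⟩
  rw [map_zsmul, hw, mul_smul]
  exact hc'.symm

/-- `p`-power saturation from the conclusion of S2 at `𝒳`. [folklore] -/
theorem lifts_all_levels_of_pow_smul
    (hsat : ∀ y : KTheory.KZero (specialFibre 𝒳).left,
      (∀ n : ℕ, ∃ z : KTheory.KZero (thickening 𝒳 (n + 1)).left,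
        KTheory.KZero.map (specialFibreToThickening 𝒳 n) z = (p : ℤ) • y) →
      ∀ n : ℕ, ∃ z : KTheory.KZero (thickening 𝒳 (n + 1)).left,
        KTheory.KZero.map (specialFibreToThickening 𝒳 n) z = y)
    {y : KTheory.KZero (specialFibre 𝒳).left} :
    ∀ a : ℕ, (∀ n : ℕ, ∃ z : KTheory.KZero (thickening 𝒳 (n + 1)).left,
        KTheory.KZero.map (specialFibreToThickening 𝒳 n) z = (p : ℤ) ^ a • y) →
      ∀ n : ℕ, ∃ z : KTheory.KZero (thickening 𝒳 (n + 1)).left,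
        KTheory.KZero.map (specialFibreToThickening 𝒳 n) z = y
  | 0, h => by simpa using h
  | a + 1, h => by
    refine lifts_all_levels_of_pow_smul hsat a (hsat _ ?_)
    rw [← mul_smul, ← pow_succ']
    exact h

/-- **(T2) S2 ∧ S3 at `𝒳` force every rationally pro-liftable `[E₁]` to lift INTEGRALLY to every
level.** Hypotheses: `hsat` = the conclusion of `stub_pSaturation` at `𝒳`, `hdiv` = the conclusion of
`stub_primeToPLifting` at `𝒳`, `hξ` = the rational pro-class clause of the crux, all verbatim.
[folklore] -/
theorem exists_lift_all_levels_of_stubs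
    (hsat : ∀ y : KTheory.KZero (specialFibre 𝒳).left,
      (∀ n : ℕ, ∃ z : KTheory.KZero (thickening 𝒳 (n + 1)).left,
        KTheory.KZero.map (specialFibreToThickening 𝒳 n) z = (p : ℤ) • y) →
      ∀ n : ℕ, ∃ z : KTheory.KZero (thickening 𝒳 (n + 1)).left,
        KTheory.KZero.map (specialFibreToThickening 𝒳 n) z = y)
    (hdiv : ∀ (n M : ℕ), ¬ p ∣ M → ∀ y : KTheory.KZero (specialFibre 𝒳).left,
      (∃ z : KTheory.KZero (thickening 𝒳 (n + 1)).left,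
        KTheory.KZero.map (specialFibreToThickening 𝒳 n) z = (M : ℤ) • y) →
      ∃ z : KTheory.KZero (thickening 𝒳 (n + 1)).left,
        KTheory.KZero.map (specialFibreToThickening 𝒳 n) z = y)
    {E₁ : (specialFibre 𝒳).left.Modules} (hE₁ : IsFiniteLocallyFree E₁)
    (hξ : ∃ ξ : KTheory.ContinuousKZeroRat (Ideal.span {(p : WittVector p k)}) 𝒳,
      KTheory.KZeroRat.map (Crystalline.specialFibreToTower 𝒳)
        (KTheory.ContinuousKZeroRat.specialFibre (Ideal.span {(p : WittVector p k)}) 𝒳 ξ) =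
        KTheory.KZeroRat.of E₁ hE₁) (n : ℕ) :
    ∃ z : KTheory.KZero (thickening 𝒳 (n + 1)).left,
      KTheory.KZero.map (specialFibreToThickening 𝒳 n) z = KTheory.KZero.of E₁ hE₁ := by
  obtain ⟨M, hM, hlift⟩ := exists_int_multiple_lifts_all_levels hE₁ hξ
  -- `M = ± p^a N'` with `p ∤ N'`
  obtain ⟨N, rfl | rfl⟩ := Int.eq_nat_or_neg M
  · have hN : N ≠ 0 := by exact_mod_cast hM
    obtain ⟨a, N', hN', rfl⟩ :=
      Nat.exists_eq_pow_mul_and_not_dvd hN p (Fact.out : p.Prime).one_lt.ne'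
    refine lifts_all_levels_of_pow_smul hsat a (fun m => hdiv m N' hN' _ ?_) n
    have e : ((p ^ a * N' : ℕ) : ℤ) • KTheory.KZero.of E₁ hE₁ =
        (N' : ℤ) • ((p : ℤ) ^ a • KTheory.KZero.of E₁ hE₁) := by
      rw [Nat.cast_mul, Nat.cast_pow, mul_comm, mul_smul]
    rw [← e]
    exact hlift m
  · have hN : N ≠ 0 := by simpa using hM
    obtain ⟨a, N', hN', rfl⟩ :=
      Nat.exists_eq_pow_mul_and_not_dvd hN p (Fact.out : p.Prime).one_lt.ne'
    refine lifts_all_levels_of_pow_smul hsat a (fun m => hdiv m N' hN' _ ?_) n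
    obtain ⟨z, hz⟩ := hlift m
    refine ⟨-z, ?_⟩
    rw [map_neg, hz, neg_smul, neg_neg, Nat.cast_mul, Nat.cast_pow, mul_comm, mul_smul]

/-- **DICHOTOMY: the one-step witness is a stub counterexample.** If `[E₁]` carries the crux's rational
pro-class but does not lift to `K₀(X_2)` (the witness of `Negative/OneStepClassLift.lean`, which refutes
the crux modulo the folklore converse), then at that very `𝒳` the conclusion of `stub_pSaturation` or
the conclusion of `stub_primeToPLifting` FAILS. [folklore] -/
theorem not_pSaturation_or_not_primeToPLifting_of_oneStepWitness
    {E₁ : (specialFibre 𝒳).left.Modules} (hE₁ : IsFiniteLocallyFree E₁)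
    (hξ : ∃ ξ : KTheory.ContinuousKZeroRat (Ideal.span {(p : WittVector p k)}) 𝒳,
      KTheory.KZeroRat.map (Crystalline.specialFibreToTower 𝒳)
        (KTheory.ContinuousKZeroRat.specialFibre (Ideal.span {(p : WittVector p k)}) 𝒳 ξ) =
        KTheory.KZeroRat.of E₁ hE₁)
    (h : ¬ ∃ y : KTheory.KZero (thickening 𝒳 2).left,
      KTheory.KZero.map (specialFibreToThickening 𝒳 1) y = KTheory.KZero.of E₁ hE₁) :
    (¬ ∀ y : KTheory.KZero (specialFibre 𝒳).left,
      (∀ n : ℕ, ∃ z : KTheory.KZero (thickening 𝒳 (n + 1)).left,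
        KTheory.KZero.map (specialFibreToThickening 𝒳 n) z = (p : ℤ) • y) →
      ∀ n : ℕ, ∃ z : KTheory.KZero (thickening 𝒳 (n + 1)).left,
        KTheory.KZero.map (specialFibreToThickening 𝒳 n) z = y) ∨
    (¬ ∀ (n M : ℕ), ¬ p ∣ M → ∀ y : KTheory.KZero (specialFibre 𝒳).left,
      (∃ z : KTheory.KZero (thickening 𝒳 (n + 1)).left,
        KTheory.KZero.map (specialFibreToThickening 𝒳 n) z = (M : ℤ) • y) →
      ∃ z : KTheory.KZero (thickening 𝒳 (n + 1)).left,
        KTheory.KZero.map (specialFibreToThickening 𝒳 n) z = y) := by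
  by_contra hc
  rw [not_or, not_not, not_not] at hc
  exact h (exists_lift_all_levels_of_stubs hc.1 hc.2 hE₁ hξ 1)

end Saturation

/-! ## (T3) Toy tightness of the stub set (abstract towers) -/

section Toys

/-- **S2 IS INDEPENDENT OF S1 AND OF "ALL COKERNELS KILLED BY ONE PRIME"** (toy): a tower of abelian
groups `A (n+1) → A n`, with compatible restriction maps `res n : A n → A 0`, whose kernel tower is
surjective (the shape of S1) and in which `q • y` lifts to every level for EVERY `y` (cokernels killed
by `q`, and the hypothesis of S2 holds universally), yet `y = 1` lifts to no level `≥ 1`: the constant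
tower `ℤ` with bottom map `×q` and identity transitions. The shape of the Godeaux–Serre failure: the
limit of the obstruction groups (`ℤ/q`) has torsion, which is exactly what S2 excludes and what S1 + S3
cannot see. [folklore] -/
theorem pSaturation_independent_toy (q : ℤ) (hq : 2 ≤ q) :
    ∃ (A : ℕ → Type) (_ : ∀ n, AddCommGroup (A n)) (r : ∀ n, A (n + 1) →+ A n)
      (res : ∀ n, A n →+ A 0),
      res 0 = AddMonoidHom.id (A 0) ∧ (∀ n, res (n + 1) = (res n).comp (r n)) ∧
      (∀ (n : ℕ) (t : A (n + 1)), res (n + 1) t = 0 →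
        ∃ t' : A (n + 2), res (n + 2) t' = 0 ∧ r (n + 1) t' = t) ∧
      (∀ (n : ℕ) (y : A 0), ∃ z : A (n + 1), res (n + 1) z = q • y) ∧
      ¬ ∀ y : A 0, (∀ n, ∃ z : A (n + 1), res (n + 1) z = q • y) →
        ∀ n, ∃ z : A (n + 1), res (n + 1) z = y := by
  let A : ℕ → Type := fun _ => ℤ
  let inst : ∀ n, AddCommGroup (A n) := fun _ => inferInstanceAs (AddCommGroup ℤ)
  let r : ∀ n, A (n + 1) →+ A n := fun m => match m with
    | 0 => (AddMonoidHom.mulLeft q : ℤ →+ ℤ)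
    | _ + 1 => AddMonoidHom.id ℤ
  let res : ∀ n, A n →+ A 0 := fun m => match m with
    | 0 => AddMonoidHom.id ℤ
    | _ + 1 => (AddMonoidHom.mulLeft q : ℤ →+ ℤ)
  have hres : ∀ (n : ℕ) (z : ℤ), res (n + 1) z = q * z := fun _ _ => rfl
  refine ⟨A, inst, r, res, rfl, ?_, ?_, ?_, ?_⟩
  · intro n
    cases n with
    | zero => rfl
    | succ n => rfl
  · intro n t ht
    refine ⟨t, ?_, rfl⟩
    have h1 : q * t = 0 := (hres n t).symm.trans ht
    exact (hres (n + 1) t).trans h1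
  · intro n y
    exact ⟨y, (hres n y).trans (smul_eq_mul q y).symm⟩
  · intro h
    obtain ⟨z, hz⟩ := h 1 (fun n => ⟨1, (hres n 1).trans (smul_eq_mul q 1).symm⟩) 0
    have hz' : q * z = 1 := (hres 0 z).symm.trans hz
    have h1 : q ∣ 1 := ⟨z, hz'.symm⟩
    have h2 : q ≤ 1 := Int.le_of_dvd one_pos h1
    omega

/-- **LIFTS AT EVERY LEVEL GIVE NO COMPATIBLE FAMILY WITHOUT S1** (toy; the `lim¹` phenomenon):
`A 0 = ℤ/2`, `A (n+1) = ℤ`, restriction = reduction mod `2`, transitions `×3` (compatible, as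
`3 ≡ 1 mod 2`): `1` lifts to every level, while a compatible family `(x_n)` has `x_1 ∈ ⋂ₙ 3ⁿℤ = 0`, so
`x_0 = 0 ≠ 1`. Its kernel tower `2ℤ →(×3) 2ℤ` is not surjective — the failure of S1 is what permits
this. [folklore] -/
theorem levelwiseLifts_not_compatible_toy :
    ∃ (A : ℕ → Type) (_ : ∀ n, AddCommGroup (A n)) (r : ∀ n, A (n + 1) →+ A n)
      (res : ∀ n, A n →+ A 0) (y : A 0),
      res 0 = AddMonoidHom.id (A 0) ∧ (∀ n, res (n + 1) = (res n).comp (r n)) ∧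
      (∀ n, ∃ z : A (n + 1), res (n + 1) z = y) ∧
      ¬ ∃ x : ∀ n, A n, (∀ n, r n (x (n + 1)) = x n) ∧ x 0 = y := by
  let A : ℕ → Type := fun m => match m with | 0 => ZMod 2 | _ + 1 => ℤ
  let inst : ∀ n, AddCommGroup (A n) := fun m => match m with
    | 0 => inferInstanceAs (AddCommGroup (ZMod 2))
    | _ + 1 => inferInstanceAs (AddCommGroup ℤ)
  let r : ∀ n, A (n + 1) →+ A n := fun m => match m with
    | 0 => (Int.castAddHom (ZMod 2) : ℤ →+ ZMod 2)
    | _ + 1 => (AddMonoidHom.mulLeft (3 : ℤ) : ℤ →+ ℤ)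
  let res : ∀ n, A n →+ A 0 := fun m => match m with
    | 0 => AddMonoidHom.id (ZMod 2)
    | _ + 1 => (Int.castAddHom (ZMod 2) : ℤ →+ ZMod 2)
  have h3 : ((3 : ℤ) : ZMod 2) = 1 := by decide
  refine ⟨A, inst, r, res, (1 : ZMod 2), rfl, ?_, fun n => ⟨(1 : ℤ), ?_⟩, ?_⟩
  · intro n
    cases n with
    | zero => rfl
    | succ n =>
      refine AddMonoidHom.ext fun z => ?_
      change ((z : ℤ) : ZMod 2) = (((3 : ℤ) * z : ℤ) : ZMod 2)
      rw [Int.cast_mul, h3, one_mul]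
  · change (((1 : ℤ) : ℤ) : ZMod 2) = 1
    rw [Int.cast_one]
  · rintro ⟨x, hx, hx0⟩
    -- `x 1 = 3ⁿ · x (n+1)` for every `n`
    have hmul : ∀ n : ℕ, (x 1 : ℤ) = 3 ^ n * (x (n + 1) : ℤ) := by
      intro n
      induction n with
      | zero => simp
      | succ n ih =>
        have h := hx (n + 1)
        change (3 : ℤ) * x (n + 2) = x (n + 1) at h
        rw [ih, ← h, pow_succ, mul_assoc]
    have hx1 : (x 1 : ℤ) = 0 := by
      refine Int.eq_zero_of_abs_lt_dvd ⟨x ((x 1 : ℤ).natAbs + 1), hmul _⟩ ?_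
      have hlt : (x 1 : ℤ).natAbs < 3 ^ (x 1 : ℤ).natAbs :=
        Nat.lt_pow_self (by norm_num : 1 < 3)
      have hlt' : (((x 1 : ℤ).natAbs : ℕ) : ℤ) < (3 : ℤ) ^ (x 1 : ℤ).natAbs := by
        exact_mod_cast hlt
      rwa [Int.natCast_natAbs] at hlt'
    have h0 := hx 0
    change ((x 1 : ℤ) : ZMod 2) = x 0 at h0
    rw [hx1, hx0, Int.cast_zero] at h0
    exact zero_ne_one h0

end Toys

end

end Summit.HodgeConjecture.HodgeConjecture.Theorems.FormalLiftingFromClassLifting.Negative
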